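import Mathlib
import Summits.BirchSwinnertonDyer.BirchSwinnertonDyer.Theorems.KatoDescentTamePotSupersingularTameLowerFibreAdjointBricksFivePadic
import Literature.GroupTheory.SpecificGroups.SL2PadicSerreLemma
import Literature.LinearAlgebra.Matrix.SpecialLinearReductionSurjective

/-!
# Bricks for the `GL₂(𝔽₅)`-lifting route (T5′), XVIII: Kato's (12.5.2) shape — the conjugate of
# `SL₂(ℤ₅)` lies in every closed subgroup containing the commutators (the image of `Gal(ℚ̄/ℚ(ζ_{5^∞}))`)

Continuation of file XVII (`…AdjointBricksFivePadic`, same namespace). File XVII is ADD-1 §C (C0) in the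
Skinner–Urban shape: a closed `G ≤ GL₂(A)` covering `GL₂(𝔽₅)` modulo `𝔪` contains `u · φ(SL₂(ℤ₅)) · u⁻¹`
for some `u ≡ 1 (mod 𝔪)` and every ring map `φ : ℤ₅ → A`. Kato's hypothesis (12.5.2) (Astérisque 295,
Thm. 12.5 (4), p. 222) asks the same inclusion for the image of the SMALLER group `Gal(ℚ̄/ℚ(ζ_{p^∞}))`,
whose residual image is in general only `SL₂(𝔽₅)·(scalars)` — and (T5′) is FALSE for residual image
`SL₂(𝔽₅)` ([M] = Manoharmayum 2015, Remark 4.4), so XVII cannot simply be re-applied to that subgroup.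
This file supplies the missing step in the instance-free currency of XVI/XVII: if `N ≤ GL₂(A)` is closed
(entrywise modulo every `𝔪ⁿ`) and contains every commutator `a b a⁻¹ b⁻¹` of elements of `G` — as
`ρ(Gal(ℚ̄/ℚ(ζ_{5^∞})))` does inside `ρ(G_ℚ)`, `ℚ(ζ_{5^∞})/ℚ` being abelian — then the SAME `u` gives
`u · φ(SL₂(ℤ₅)) · u⁻¹ ⊆ N` (`exists_conj_SL2_padicInt_le_of_closed_of_commutator_le`). Proof: the preimage
`X ≤ SL₂(ℤ₅)` of `N` under `s ↦ u φ(s) u⁻¹` is a closed subgroup (the map is `5`-adically contracting into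
the `𝔪`-adic filtration) containing all commutators of `SL₂(ℤ₅)` (their conjugates are commutators of
elements of `G`), hence mapping onto the perfect group `SL₂(𝔽₅)` (Mathlib `Matrix.SL2.commutator_eq_top`,
reduction `SL₂(ℤ₅) → SL₂(𝔽₅)` onto via `SL₂(ℤ) → SL₂(ℤ/5)`), hence all of `SL₂(ℤ₅)` by Serre's lemma
(tree `Literature.GroupTheory.SpecificGroups.SL2_eq_top_of_isClosed_of_map_toZMod_eq_top`, `l = 5`).
Route-free, no definitions, nothing about elliptic curves or items 19618/19981 (open). Target T-S7r07-1
(`FibreLatticeInput 5`, Δ1@5): reading R3 of `Fouquet2024/OrdinaryFibreRankZeroBSD.lean` («(12.5.2) from the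
lattice clause») for every fibre member.
-/

set_option linter.dupNamespace false

open Matrix
open scoped MatrixGroups commutatorElement

namespace Summit.BirchSwinnertonDyer.BirchSwinnertonDyer.Theorems.GL2F5AdjointBricks

section commutator

universe u

/-- Entries of `P * M * Q` lie in an ideal `I` as soon as those of `M` do. -/
theorem mul_mul_apply_mem_of_forall_mem {A : Type u} [CommRing A] (I : Ideal A) {n : Type*} [Fintype n]
    (P M Q : Matrix n n A) (hM : ∀ i j, M i j ∈ I) (i j : n) : (P * M * Q) i j ∈ I := by
  rw [Matrix.mul_apply]
  refine I.sum_mem fun l _ => I.mul_mem_right _ ?_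
  rw [Matrix.mul_apply]
  exact I.sum_mem fun k _ => I.mul_mem_left _ (hM k l)

/-- A ring map `φ : ℤ_p → A` with `↑p ∈ 𝔪` sends the ball `‖x‖ ≤ p⁻ⁿ` (= `pⁿ ℤ_p`) into `𝔪ⁿ`. -/
theorem map_mem_pow_of_norm_le {p : ℕ} [Fact p.Prime] {A : Type u} [CommRing A] (𝔪 : Ideal A)
    (hp : (p : A) ∈ 𝔪) (φ : ℤ_[p] →+* A) {x : ℤ_[p]} {n : ℕ} (hx : ‖x‖ ≤ (p : ℝ) ^ (-n : ℤ)) :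
    φ x ∈ 𝔪 ^ n := by
  rw [PadicInt.norm_le_pow_iff_mem_span_pow, Ideal.mem_span_singleton'] at hx
  obtain ⟨c, rfl⟩ := hx
  rw [map_mul, map_pow, map_natCast]
  exact Ideal.mul_mem_left _ _ (Ideal.pow_mem_pow hp n)

/-- Reduction `SL₂(ℤ_p) → SL₂(𝔽_p)` (indeed `SL_n`) is onto — through `SL_n(ℤ) → SL_n(ℤ/p)`
(tree: `IntegerSpecialLinear.specialLinearGroup_map_intCast_zmod_surjective`). -/
theorem specialLinearGroup_map_toZMod_surjective {p : ℕ} [Fact p.Prime] {n : Type*} [DecidableEq n]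
    [Fintype n] :
    Function.Surjective (Matrix.SpecialLinearGroup.map (n := n) (PadicInt.toZMod (p := p))) := by
  haveI : NeZero p := ⟨(Fact.out : p.Prime).ne_zero⟩
  intro g
  obtain ⟨V, hV⟩ :=
    Literature.LinearAlgebra.Matrix.IntegerSpecialLinear.specialLinearGroup_map_intCast_zmod_surjective p g
  refine ⟨Matrix.SpecialLinearGroup.map (Int.castRingHom ℤ_[p]) V, ?_⟩
  rw [← hV]
  have hcomp : (PadicInt.toZMod (p := p)).comp (Int.castRingHom ℤ_[p]) = Int.castRingHom (ZMod p) :=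
    RingHom.ext_int _ _
  apply Matrix.SpecialLinearGroup.ext
  intro i j
  simp only [Matrix.SpecialLinearGroup.map_apply_coe, RingHom.mapMatrix_apply, Matrix.map_apply]
  rw [← RingHom.comp_apply, hcomp]

/-- For `u ∈ GL₂(A)`, a ring map `φ : ℤ_p → A` with `↑p ∈ 𝔪`, and a subgroup `N ≤ GL₂(A)` closed entrywise
modulo every `𝔪ⁿ`, the preimage of `N` under `s ↦ u · φ(s) · u⁻¹` is a CLOSED subgroup of `SL₂(ℤ_p)`. -/
theorem isClosed_comap_conj_map_toGL {p : ℕ} [Fact p.Prime] {A : Type u} [CommRing A] (𝔪 : Ideal A)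
    (hp : (p : A) ∈ 𝔪) (φ : ℤ_[p] →+* A) (u : GL (Fin 2) A) (N : Subgroup (GL (Fin 2) A))
    (hN : ∀ g : GL (Fin 2) A, (∀ n : ℕ, ∃ g' ∈ N, ∀ i j, g.val i j - g'.val i j ∈ 𝔪 ^ n) → g ∈ N) :
    IsClosed ((N.comap ((MulAut.conj u).toMonoidHom.comp
      ((Matrix.GeneralLinearGroup.map φ).comp
        (Matrix.SpecialLinearGroup.toGL : SL(2, ℤ_[p]) →* GL (Fin 2) ℤ_[p]))) : Subgroup SL(2, ℤ_[p])) :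
          Set SL(2, ℤ_[p])) := by
  set f : SL(2, ℤ_[p]) →* GL (Fin 2) A := (MulAut.conj u).toMonoidHom.comp
      ((Matrix.GeneralLinearGroup.map φ).comp
        (Matrix.SpecialLinearGroup.toGL : SL(2, ℤ_[p]) →* GL (Fin 2) ℤ_[p])) with hfdef
  have hval : ∀ x : SL(2, ℤ_[p]),
      (f x).val = u.val * φ.mapMatrix (x : Matrix (Fin 2) (Fin 2) ℤ_[p]) * (u⁻¹).val := fun x => rfl
  apply isClosed_of_closure_subset
  intro s hs
  rw [SetLike.mem_coe, Subgroup.mem_comap]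
  apply hN
  intro n
  have hp0 : (0 : ℝ) < p := by exact_mod_cast (Fact.out : p.Prime).pos
  set r : ℝ := (p : ℝ) ^ (-n : ℤ) with hr
  have hr0 : 0 < r := zpow_pos hp0 _
  -- an open box around `s`
  set O : Set SL(2, ℤ_[p]) := ⋂ i : Fin 2, ⋂ j : Fin 2,
      (fun t : SL(2, ℤ_[p]) => (t : Matrix (Fin 2) (Fin 2) ℤ_[p]) i j) ⁻¹'
        Metric.ball ((s : Matrix (Fin 2) (Fin 2) ℤ_[p]) i j) r with hO
  have hind : Topology.IsInducing (fun t : SL(2, ℤ_[p]) => (t : Matrix (Fin 2) (Fin 2) ℤ_[p])) := ⟨rfl⟩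
  have hOopen : IsOpen O :=
    isOpen_iInter_of_finite fun i => isOpen_iInter_of_finite fun j =>
      (((continuous_apply j).comp ((continuous_apply i).comp hind.continuous)).isOpen_preimage _
        Metric.isOpen_ball)
  have hsO : s ∈ O := by
    simp only [hO, Set.mem_iInter, Set.mem_preimage, Metric.mem_ball, dist_self]
    exact fun _ _ => hr0
  obtain ⟨t, htO, htX⟩ := (mem_closure_iff.1 hs) O hOopen hsO
  refine ⟨f t, htX, fun i j => ?_⟩
  have e : (f s).val - (f t).val =
      u.val * φ.mapMatrix ((s : Matrix (Fin 2) (Fin 2) ℤ_[p]) - (t : Matrix (Fin 2) (Fin 2) ℤ_[p])) *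
        (u⁻¹).val := by
    rw [hval, hval, map_sub, Matrix.mul_sub, Matrix.sub_mul]
  rw [← Matrix.sub_apply, e]
  refine mul_mul_apply_mem_of_forall_mem (𝔪 ^ n) _ _ _ (fun k l => ?_) i j
  rw [RingHom.mapMatrix_apply, Matrix.map_apply, Matrix.sub_apply]
  refine map_mem_pow_of_norm_le 𝔪 hp φ ?_
  have hkl : t ∈ (fun t : SL(2, ℤ_[p]) => (t : Matrix (Fin 2) (Fin 2) ℤ_[p]) k l) ⁻¹'
      Metric.ball ((s : Matrix (Fin 2) (Fin 2) ℤ_[p]) k l) r :=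
    Set.mem_iInter.1 (Set.mem_iInter.1 htO k) l
  rw [Set.mem_preimage, Metric.mem_ball, dist_eq_norm] at hkl
  rw [← neg_sub, norm_neg]
  exact hkl.le

/-- **(T5′) in Kato's (12.5.2) shape (ARM-P r07 S7 ADD-1 §C (C0) + (h), refined).** Let `(A, 𝔪)` be a
precomplete local pair with finite levels, `5 ∈ 𝔪 ∌ 1`, units off `𝔪`; `G ≤ GL₂(A)` closed (entrywise
modulo every `𝔪ⁿ`) covering `GL₂(𝔽₅)` modulo `𝔪`; and `N ≤ GL₂(A)` closed and containing every commutator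
`a b a⁻¹ b⁻¹` of elements of `G` (e.g. `G = ρ(G_ℚ)`, `N = ρ(Gal(ℚ̄/ℚ(ζ_{5^∞})))`). Then ONE `u ∈ GL₂(A)` with
`u ≡ 1 (mod 𝔪)` satisfies, for EVERY ring map `φ : ℤ₅ → A` and every `s ∈ SL₂(ℤ₅)`:
`u · φ(s) · u⁻¹ ∈ G` AND `u · φ(s) · u⁻¹ ∈ N` — `N` contains a conjugate of `SL₂(ℤ₅)` although its
residual image need not be `GL₂(𝔽₅)`. -/
theorem exists_conj_SL2_padicInt_le_of_closed_of_commutator_le [Fact (Nat.Prime 5)] (A : Type u)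
    [CommRing A] (𝔪 : Ideal A) [IsPrecomplete 𝔪 A]
    (hfin : ∀ n : ℕ, Finite (A ⧸ 𝔪 ^ (n + 1))) (h5 : (5 : A) ∈ 𝔪) (h1 : (1 : A) ∉ 𝔪)
    (hloc : ∀ a : A, a ∉ 𝔪 → IsUnit a) (G N : Subgroup (GL (Fin 2) A))
    (hclosed : ∀ g : GL (Fin 2) A, (∀ n : ℕ, ∃ g' ∈ G, ∀ i j, g.val i j - g'.val i j ∈ 𝔪 ^ n) → g ∈ G)
    (hNclosed : ∀ g : GL (Fin 2) A, (∀ n : ℕ, ∃ g' ∈ N, ∀ i j, g.val i j - g'.val i j ∈ 𝔪 ^ n) → g ∈ N)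
    (hGN : ∀ a ∈ G, ∀ b ∈ G, a * b * a⁻¹ * b⁻¹ ∈ N)
    (hres : ∀ q : GL (Fin 2) (ZMod 5), ∃ g ∈ G, ∀ i j, g.val i j - ((q.val i j).val : ℕ) ∈ 𝔪) :
    ∃ u : GL (Fin 2) A, (∀ i j, u.val i j - (1 : Matrix (Fin 2) (Fin 2) A) i j ∈ 𝔪) ∧
      ∀ (φ : ℤ_[5] →+* A) (s : Matrix.SpecialLinearGroup (Fin 2) ℤ_[5]),
        u * Matrix.GeneralLinearGroup.map φ (Matrix.SpecialLinearGroup.toGL s) * u⁻¹ ∈ G ∧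
          u * Matrix.GeneralLinearGroup.map φ (Matrix.SpecialLinearGroup.toGL s) * u⁻¹ ∈ N := by
  obtain ⟨u, hu1, hu⟩ := exists_conj_SL2_padicInt_le_of_closed A 𝔪 hfin h5 h1 hloc G hclosed hres
  refine ⟨u, hu1, fun φ s => ⟨hu φ s, ?_⟩⟩
  -- the closed subgroup `X = {s : u φ(s) u⁻¹ ∈ N}` of `SL₂(ℤ₅)`
  set f : SL(2, ℤ_[5]) →* GL (Fin 2) A := (MulAut.conj u).toMonoidHom.comp
      ((Matrix.GeneralLinearGroup.map φ).comp
        (Matrix.SpecialLinearGroup.toGL : SL(2, ℤ_[5]) →* GL (Fin 2) ℤ_[5])) with hfdef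
  have hf : ∀ x : SL(2, ℤ_[5]),
      f x = u * Matrix.GeneralLinearGroup.map φ (Matrix.SpecialLinearGroup.toGL x) * u⁻¹ := fun x => rfl
  set X : Subgroup SL(2, ℤ_[5]) := N.comap f with hXdef
  have hXc : IsClosed (X : Set SL(2, ℤ_[5])) :=
    isClosed_comap_conj_map_toGL 𝔪 (by exact_mod_cast h5) φ u N hNclosed
  -- `X` contains all commutators, so it maps onto the perfect group `SL₂(𝔽₅)`
  have hXs : X.map (Matrix.SpecialLinearGroup.map (PadicInt.toZMod (p := 5))) = ⊤ := by
    obtain ⟨h2, h4⟩ := Literature.GroupTheory.SpecificGroups.two_ne_zero_and_sq_ne_one (l := 5) le_rfl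
    rw [eq_top_iff, ← Matrix.SL2.commutator_eq_top h2 h4, commutator_def, Subgroup.commutator_le]
    rintro a' - b' -
    obtain ⟨a, rfl⟩ := specialLinearGroup_map_toZMod_surjective (p := 5) a'
    obtain ⟨b, rfl⟩ := specialLinearGroup_map_toZMod_surjective (p := 5) b'
    refine ⟨⁅a, b⁆, ?_, by rw [map_commutatorElement]⟩
    show f ⁅a, b⁆ ∈ N
    rw [map_commutatorElement, commutatorElement_def]
    exact hGN _ (by rw [hf]; exact hu φ a) _ (by rw [hf]; exact hu φ b)
  -- Serre's lemma (`l = 5`)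
  have hX := Literature.GroupTheory.SpecificGroups.SL2_eq_top_of_isClosed_of_map_toZMod_eq_top
    (l := 5) le_rfl X hXc hXs
  have hs : s ∈ X := by rw [hX]; exact Subgroup.mem_top _
  rw [hXdef, Subgroup.mem_comap, hf] at hs
  exact hs

/-- **(T5′) in Kato's (12.5.2) shape for complete local rings (class-level hypotheses).** The same as
`exists_conj_SL2_padicInt_le_of_closed_of_commutator_le` for `A` a local ring, adically complete for its
maximal ideal `𝔪`, with `5 ∈ 𝔪` and finite levels — e.g. `A = 𝒪_𝔭` for a finite extension of `ℚ₅`: if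
`G ≤ GL₂(A)` is closed with reduction covering `GL₂(𝔽₅)` and `N ≤ GL₂(A)` is closed and contains the
commutators of `G`, then `u · φ(SL₂(ℤ₅)) · u⁻¹ ⊆ N` (and `⊆ G`) for some `u ≡ 1 (mod 𝔪)` and every ring map
`φ : ℤ₅ → A`. -/
theorem exists_conj_SL2_padicInt_le_of_closed_of_commutator_le_localRing [Fact (Nat.Prime 5)]
    (A : Type u) [CommRing A] [IsLocalRing A] [IsAdicComplete (IsLocalRing.maximalIdeal A) A]
    (hfin : ∀ n : ℕ, Finite (A ⧸ IsLocalRing.maximalIdeal A ^ (n + 1)))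
    (h5 : (5 : A) ∈ IsLocalRing.maximalIdeal A) (G N : Subgroup (GL (Fin 2) A))
    (hclosed : ∀ g : GL (Fin 2) A,
      (∀ n : ℕ, ∃ g' ∈ G, ∀ i j, g.val i j - g'.val i j ∈ IsLocalRing.maximalIdeal A ^ n) → g ∈ G)
    (hNclosed : ∀ g : GL (Fin 2) A,
      (∀ n : ℕ, ∃ g' ∈ N, ∀ i j, g.val i j - g'.val i j ∈ IsLocalRing.maximalIdeal A ^ n) → g ∈ N)
    (hGN : ∀ a ∈ G, ∀ b ∈ G, a * b * a⁻¹ * b⁻¹ ∈ N)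
    (hres : ∀ q : GL (Fin 2) (ZMod 5), ∃ g ∈ G, ∀ i j,
      g.val i j - ((q.val i j).val : ℕ) ∈ IsLocalRing.maximalIdeal A) :
    ∃ u : GL (Fin 2) A, (∀ i j, u.val i j - (1 : Matrix (Fin 2) (Fin 2) A) i j ∈ IsLocalRing.maximalIdeal A) ∧
      ∀ (φ : ℤ_[5] →+* A) (s : Matrix.SpecialLinearGroup (Fin 2) ℤ_[5]),
        u * Matrix.GeneralLinearGroup.map φ (Matrix.SpecialLinearGroup.toGL s) * u⁻¹ ∈ G ∧
          u * Matrix.GeneralLinearGroup.map φ (Matrix.SpecialLinearGroup.toGL s) * u⁻¹ ∈ N :=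
  exists_conj_SL2_padicInt_le_of_closed_of_commutator_le A (IsLocalRing.maximalIdeal A) hfin h5
    (fun h => (IsLocalRing.mem_maximalIdeal _).1 h isUnit_one)
    (fun a ha => by
      by_contra hu
      exact ha ((IsLocalRing.mem_maximalIdeal a).2 hu))
    G N hclosed hNclosed hGN hres

end commutator

end Summit.BirchSwinnertonDyer.BirchSwinnertonDyer.Theorems.GL2F5AdjointBricks
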